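import Mathlib
import Summits.ValiantsHypothesis.ValiantsHypothesis.Theorems.RigidityForcesSymmetryRankRigidMinimalReprLaplaceFiveSeparatedCaptureTwoTerm

/-!
# ValiantsHypothesis / RigidityForcesSymmetry — crux `LaplaceOptimalFive` (stmt-ValiantsHypothesis-24813), symmetric capture:
# the PENCIL LEMMA for the profiles `(1,1,r)` — the `e`-part, blind to the third span (crit-3 g8 price P3, 08:19:32Z)

Two triangle spans are LINES `ℂu₁` (cut `01`), `ℂu₂` (cut `02`); the third span is ARBITRARY: a captured obligation reads
`T(p,q,r) = u₁(p,q)a_r + u₂(p,r)b_q + C_p(q,r)` with ANY symmetric matrices `C_p`.  The single slot symmetry `(1 2)` of `T` already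
yields the TWO-TERM IDENTITY for `(u₁,a; u₂,b)` (the `C`-part cancels), hence the dichotomy of ✓ `twoTerm_binary` / ✓ `twoTerm_parallel`:
(α) some `2 × 2` minor of `(a,b)` is non-zero ⇒ `u₁, u₂` annihilate `⟨a,b⟩^⊥` (binary quadrics); (β) all minors vanish and `a ≠ 0` ⇒
`b = β·a` and `u₁ − β·u₂ = κ·a aᵀ` (✓ `rankOne_of_tensor_symm`), with `κ ≠ 0` as soon as `u₁ ∉ ℂ·u₂` — the agreement tensor
`e = κ·a⊗a⊗a` and `a aᵀ` lies in the pencil `⟨u₁,u₂⟩`; and then `T(p,q,r) = u₁(p,q)a_r + u₁(p,r)a_q − κ·a_p a_q a_r + C_p(q,r)`.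
This is the `V`-blind half of every profile `(1,1,r)`; for `r = 1` it is the first half of ✓ `lines_parallel_structure`.

* `pencil_twoTerm`, `pencil_binary`, ★ `pencil_parallel`, `pencil_kappa_ne_zero`, `pencil_parallel_form`.

Honest framing.  Per-obligation structure lemmas; close nothing; the `f`-part (prolongation of `ℂu₂ + U₁₂`: branches `ℓ²`, binary
2-plane, ternary Jacobian net `J(p)₂`) is NOT here; `CaptureIneqSym` general, K1 on `K₃ ⊔ K₂`, `LaplaceOptimalFive`
(OPEN · CONTESTED 72/120), `VP ≠ VNP` are NOT proved.  No definitions, no `sorry`.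
-/

set_option linter.dupNamespace false
set_option autoImplicit false

namespace Summit.ValiantsHypothesis.ValiantsHypothesis.Theorems.RigidityForcesSymmetryRankRigidMinimalRepr

namespace LaplaceFiveSeparatedCapture

open Finset

section pencil

variable (u₁ u₂ : Fin 5 → Fin 5 → ℂ) (hu₁ : ∀ p q, u₁ p q = u₁ q p) (hu₂ : ∀ p q, u₂ p q = u₂ q p)
  (C : Fin 5 → Fin 5 → Fin 5 → ℂ) (hC : ∀ p q r, C p q r = C p r q)
  (T : Fin 5 → Fin 5 → Fin 5 → ℂ) (a b : Fin 5 → ℂ)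
  (hT : ∀ p q r, T p q r = u₁ p q * a r + u₂ p r * b q + C p q r) (h23 : ∀ p q r, T p q r = T p r q)
include hT h23 hC

/-- TWO-TERM IDENTITY from the `(1 2)` slot symmetry alone; the third span does not enter. [folklore] -/
theorem pencil_twoTerm (p q r : Fin 5) : u₁ p q * a r - u₂ p q * b r = u₁ p r * a q - u₂ p r * b q := by
  have h := h23 p q r
  rw [hT, hT, hC p r q] at h
  linear_combination h

/-- Branch (α): a non-zero minor of `(a, b)` makes `u₁, u₂` annihilate `⟨a, b⟩^⊥`. [folklore] -/
theorem pencil_binary (r₁ r₂ : Fin 5) (hmin : a r₁ * b r₂ - a r₂ * b r₁ ≠ 0)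
    (y : Fin 5 → ℂ) (hya : ∑ i, a i * y i = 0) (hyb : ∑ i, b i * y i = 0) (p : Fin 5) :
    (∑ q, u₁ p q * y q) = 0 ∧ (∑ q, u₂ p q * y q) = 0 :=
  twoTerm_binary u₁ u₂ a b (pencil_twoTerm u₁ u₂ C hC T a b hT h23) r₁ r₂ hmin y hya hyb p

include hu₁ hu₂

/-- ★ Branch (β): all minors of `(a, b)` vanish and `a r₀ ≠ 0` ⇒ `b = β·a` and `u₁ − β·u₂ = κ·a aᵀ`. [folklore] -/
theorem pencil_parallel (hmin : ∀ r₁ r₂, a r₁ * b r₂ = a r₂ * b r₁) (r₀ : Fin 5) (ha : a r₀ ≠ 0) :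
    ∃ β κ : ℂ, (∀ r, b r = β * a r) ∧ (∀ p q, u₁ p q - β * u₂ p q = κ * (a p * a q)) := by
  have hb' := twoTerm_parallel a b hmin r₀ ha
  set β := b r₀ / a r₀ with hβ
  have hb : ∀ r, b r = β * a r := fun r => by rw [hb']; rfl
  have hM : ∀ p q r, (u₁ p q - β * u₂ p q) * a r = (u₁ p r - β * u₂ p r) * a q := by
    intro p q r
    have h := pencil_twoTerm u₁ u₂ C hC T a b hT h23 p q r
    rw [hb, hb] at h
    linear_combination h
  have hMs : ∀ p q, u₁ p q - β * u₂ p q = u₁ q p - β * u₂ q p := fun p q => by rw [hu₁ p q, hu₂ p q]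
  have hM1 := rankOne_of_tensor_symm (fun p q => u₁ p q - β * u₂ p q) a hMs hM r₀ ha
  exact ⟨β, (u₁ r₀ r₀ - β * u₂ r₀ r₀) / a r₀ ^ 2, hb, fun p q => by have := hM1 p q; linear_combination this⟩

omit hu₁ hu₂ hC hT h23 in
/-- In branch (β), `κ ≠ 0` as soon as `u₁ ∉ ℂ·u₂` (else `u₁ = β·u₂`). [folklore] -/
theorem pencil_kappa_ne_zero (h12np : ¬ ∃ κ : ℂ, u₁ = κ • u₂) (β κ : ℂ)
    (hM : ∀ p q, u₁ p q - β * u₂ p q = κ * (a p * a q)) : κ ≠ 0 := by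
  intro h0
  apply h12np
  refine ⟨β, funext fun p => funext fun q => ?_⟩
  have := hM p q
  rw [h0, zero_mul, sub_eq_zero] at this
  simpa [Pi.smul_apply, smul_eq_mul] using this

omit hu₁ hu₂ hC h23 in
/-- In branch (β) the obligation reads `T(p,q,r) = u₁(p,q)a_r + u₁(p,r)a_q − κ·a_p a_q a_r + C_p(q,r)` — the third span untouched.
[folklore] -/
theorem pencil_parallel_form (β κ : ℂ) (hb : ∀ r, b r = β * a r)
    (hM : ∀ p q, u₁ p q - β * u₂ p q = κ * (a p * a q)) (p q r : Fin 5) :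
    T p q r = u₁ p q * a r + u₁ p r * a q - κ * (a p * a q * a r) + C p q r := by
  rw [hT, hb]
  have := hM p r
  linear_combination -(a q) * this

end pencil

end LaplaceFiveSeparatedCapture

end Summit.ValiantsHypothesis.ValiantsHypothesis.Theorems.RigidityForcesSymmetryRankRigidMinimalRepr
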